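import Literature.NumberTheory.Automorphic.SupercuspidalProjectiveGL
import Literature.NumberTheory.Automorphic.ParabolicInductionProofs
import Literature.NumberTheory.Automorphic.ParabolicInductionSupercuspidalProofs
import Literature.NumberTheory.Automorphic.ParabolicInductionLeviCartanProofs
import Literature.NumberTheory.Automorphic.AdmissibleSubquotient
import HarnessLib

/-!
# No supercuspidal subquotient in a properly induced representation of `GL_n(F)`
(Casselman 1995, Cor. 5.4.3; Bernstein–Zelevinsky 1977, Thm. 2.4 (d), Cor. 2.13 (b))

Let `F` be a non-archimedean local field, `P_c = M_c U_c < GL_n(F)` a **proper** standard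
parabolic subgroup (`c : Fin n → Fin r` monotone, `IsProperBlocks c`), `σ` a representation of the
Levi `M_c ≅ Π_a GL_{n_a}(F)` which acts by scalars on the central scalars `u · 1` of `GL_n(F)`
(e.g. any irreducible admissible `σ`, `exists_apply_leviProjection_scalar_eq_smul`), and `π` an
irreducible admissible supercuspidal representation of `GL_n(F)`. Then **`π` is not a subquotient
of `i_c σ`**: every intertwining map from a subrepresentation of `i_c σ` to `π` vanishes
(`Literature.NumberTheory.Automorphic.intertwiningMap_subrepresentation_parabolicIndGL_eq_zero`).

> Casselman 1995, Corollary 5.4.3: *If `P` is a proper parabolic subgroup of `G` and `(σ, U)` is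
> an irreducible admissible representation of `M`, then no irreducible composition factor of
> `i_P^G σ` is absolutely cuspidal.*  Proof (loc. cit.): "Let `V₀` be a `G`-stable subspace of
> `i_P^G σ`, `(π, V)` an irreducible absolutely cuspidal representation of `G`, and `F : V₀ → V` a
> `G`-morphism. If `F ≠ 0`, then `F` splits by 5.4.1. But this implies that `(π, V)` is isomorphic
> to a subspace of `i_P^G σ`, a contradiction to 5.1.1."

This is the statement Bernstein–Zelevinsky 1977 use in the form 2.4 (d) ("if `M ⪇ G`, `ρ ∈ Alg M`
and `π = i_{G,M}(ρ)` then `π_c = 0`") and Cor. 2.13 (b), the key positivity input of the proof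
(§2.14) of their Thm. 2.8 (finite length of `i_{G,M}(ρ)`) and of Thm. 2.9 (uniqueness of the
cuspidal support).

## Proof (as printed, with the tree's ingredients)

* If `q : V₀ → π` is non-zero it is surjective (`π` irreducible). A central `z = u · 1` lies in
  `P_c`, its Levi projection is the tuple of scalar blocks, on which `σ` acts by a scalar `c_u`,
  so `i_c σ (z) = δ_{P_c}^{1/2}(z) c_u · id` on `Ind` (right translation by a central element of
  `P_c`, `parabolicIndGL_apply_of_mem_center`); hence `V₀` and — through the surjection `q` — `π`
  have the same central character.
* Projectivity of `π` among smooth representations with its central character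
  (`Representation.IsSupercuspidal.exists_intertwiningMap_comp_eq_id_gl`, Casselman 5.4.1 with
  Lemma 5.2.5, file `SupercuspidalProjectiveGL`) splits `q`: `π ↪ V₀ ≤ i_c σ`, a non-zero
  intertwining map `π → i_c σ`.
* Frobenius reciprocity (`frobenius_reciprocity_gl_holds`, Casselman 3.2.4 / 5.1.1) turns it into a
  non-zero `r̄_c π → σ`; but `π` is supercuspidal, so by Harish-Chandra's criterion
  (`isSupercuspidal_iff_jacquetGL_holds`, Casselman 5.3.1) the Jacquet module `r_c π` of the proper
  `P_c` is zero — contradiction.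

Theorems only; no definitions, no named facts.

## References

* W. Casselman, *Introduction to the theory of admissible representations of `p`-adic reductive
  groups* (draft 1 May 1995), Prop. 5.1.1, Thm. 5.4.1, Cor. 5.4.3, pp. 46–50. [Casselman1995]
* I. N. Bernstein, A. V. Zelevinsky, *Induced representations of reductive `p`-adic groups I*,
  Ann. Sci. ÉNS (4) 10 (1977), Thm. 2.4 (d), p. 447; Cor. 2.13 (b) and §2.14, pp. 448–449.
  [BernsteinZelevinsky1977]
-/

noncomputable section

open scoped MatrixGroups
open Function

/-! ### Schur-type preliminaries -/

namespace Representation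

/-- **Central character from Schur's lemma, with an explicit compact open subgroup** (the
variant of `Representation.exists_hasCentralCharacter_holds` usable for groups such as `GL_n(F)`
for which no `LocallyCompactSpace`/`NonarchimedeanGroup` instances are registered): an
irreducible admissible representation over an algebraically closed field of a topological group
possessing a compact open subgroup has a central character. [folklore] -/
theorem IsAdmissible.exists_hasCentralCharacter {k G V : Type*} [Field k] [IsAlgClosed k]
    [Group G] [TopologicalSpace G] [SeparatelyContinuousMul G] [AddCommGroup V] [Module k V]
    {ρ : Representation k G V} [ρ.IsIrreducible] (hρ : ρ.IsAdmissible)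
    {K₀ : Subgroup G} (hK₀o : IsOpen (K₀ : Set G)) (hK₀c : IsCompact (K₀ : Set G)) :
    ∃ χ : Subgroup.center G →* kˣ, ρ.HasCentralCharacter χ := by
  have hsc : ∀ z : Subgroup.center G, ∃ c : k, ρ (z : G) = c • (LinearMap.id : V →ₗ[k] V) :=
    fun z => hρ.exists_eq_smul_id hK₀o hK₀c (ρ (z : G)) fun g => by
      rw [← Module.End.mul_eq_comp, ← Module.End.mul_eq_comp, ← map_mul, ← map_mul,
        Subgroup.mem_center_iff.1 z.2 g]
  choose c hc using hsc
  have hc' : ∀ (z : Subgroup.center G) (v : V), ρ (z : G) v = c z • v := fun z v => by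
    rw [hc z]; rfl
  haveI : Nontrivial V := IsIrreducible.nontrivial ρ
  obtain ⟨v₀, hv₀⟩ := exists_ne (0 : V)
  have huniq : ∀ {a b : k}, a • v₀ = b • v₀ → a = b := fun {a b} h => by
    rw [← sub_eq_zero, ← sub_smul] at h
    exact sub_eq_zero.1 ((smul_eq_zero.1 h).resolve_right hv₀)
  let ω : Subgroup.center G →* k :=
    { toFun := c
      map_one' := huniq <| by rw [← hc' 1, OneMemClass.coe_one, map_one, one_smul]; rfl
      map_mul' := fun z w => huniq <| by
        rw [← hc' (z * w), Subgroup.coe_mul, map_mul, Module.End.mul_apply, hc' w, map_smul,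
          hc' z, smul_smul, mul_comm] }
  refine ⟨ω.toHomUnits, fun z => ?_⟩
  rw [MonoidHom.coe_toHomUnits]
  exact hc z

/-- An intertwining map into an irreducible representation is zero or surjective (its range is a
subrepresentation). [folklore] -/
theorem IntertwiningMap.surjective_or_eq_zero {k G V W : Type*} [Field k] [Group G]
    [AddCommGroup V] [Module k V] [AddCommGroup W] [Module k W] {ρ : Representation k G V}
    {σ : Representation k G W} [σ.IsIrreducible] (f : ρ.IntertwiningMap σ) :
    Function.Surjective f ∨ f = 0 := by
  rcases eq_bot_or_eq_top f.range with h | h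
  · right
    refine IntertwiningMap.ext (LinearMap.ext fun v => ?_)
    have hv : f v ∈ f.range := (IntertwiningMap.mem_range _ _ f (f v)).2 ⟨v, rfl⟩
    rw [h, Subrepresentation.mem_bot_iff] at hv
    exact hv
  · left
    intro w
    have hw : w ∈ f.range := by rw [h]; exact Subrepresentation.mem_top' w
    exact (IntertwiningMap.mem_range _ _ f w).1 hw

end Representation

namespace Literature.NumberTheory.Automorphic

open Representation Matrix Literature.RepresentationTheory.FiniteGroups

/-! ### Central scalars in the standard parabolic and its Levi -/

section Scalars

variable {F : Type*} [Field F] {n r : ℕ} (c : Fin n → Fin r)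

/-- A scalar matrix lies in every standard parabolic subgroup (it is diagonal). [folklore] -/
theorem scalar_mem_standardParabolicGL (u : Fˣ) :
    Matrix.GeneralLinearGroup.scalar (Fin n) u ∈ standardParabolicGL F c := by
  rw [mem_standardParabolicGL_iff, Matrix.GeneralLinearGroup.coe_scalar, Matrix.scalar_apply]
  exact Matrix.blockTriangular_diagonal _

/-- The Levi projection of a scalar matrix has scalar blocks. [folklore] -/
theorem coe_leviProjection_scalar (u : Fˣ) (a : Fin r) :
    ((leviProjection F c ⟨_, scalar_mem_standardParabolicGL c u⟩ a : GL {i // c i = a} F) :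
        Matrix {i // c i = a} {i // c i = a} F) = Matrix.scalar {i // c i = a} (u : F) := by
  rw [coe_leviProjection_apply]
  ext i j
  change ((Matrix.GeneralLinearGroup.scalar (Fin n) u : GL (Fin n) F) :
    Matrix (Fin n) (Fin n) F) i j = _
  rw [Matrix.GeneralLinearGroup.coe_scalar, Matrix.scalar_apply, Matrix.scalar_apply,
    Matrix.diagonal_apply, Matrix.diagonal_apply]
  simp only [Subtype.ext_iff]

/-- The Levi projection of a central scalar commutes with the whole Levi. [folklore] -/
theorem leviProjection_scalar_comm (u : Fˣ) (m : Π a, GL {i // c i = a} F) :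
    m * leviProjection F c ⟨_, scalar_mem_standardParabolicGL c u⟩ =
      leviProjection F c ⟨_, scalar_mem_standardParabolicGL c u⟩ * m := by
  funext a
  ext1
  rw [Pi.mul_apply, Pi.mul_apply, Units.val_mul, Units.val_mul, coe_leviProjection_scalar]
  exact (Matrix.scalar_commute (u : F) (Commute.all _) _).symm.eq

variable {c} in
/-- An irreducible admissible representation of the Levi acts by scalars on the Levi projections
of the central scalars `u · 1` (Schur's lemma with the compact open `Π_a GL_{n_a}(𝒪)`).
[folklore] -/
theorem exists_apply_leviProjection_scalar_eq_smul [ValuativeRel F] [TopologicalSpace F]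
    [IsNonarchimedeanLocalField F] {W : Type*} [AddCommGroup W] [Module ℂ W]
    (σ : Representation ℂ (Π a, GL {i // c i = a} F) W) [σ.IsIrreducible] (hσ : σ.IsAdmissible)
    (u : Fˣ) : ∃ cu : ℂ, ∀ w,
      σ (leviProjection F c ⟨_, scalar_mem_standardParabolicGL c u⟩) w = cu • w := by
  obtain ⟨cu, hcu⟩ := hσ.exists_eq_smul_id (isOpen_leviIntegral F c) (isCompact_leviIntegral F c)
    (σ (leviProjection F c ⟨_, scalar_mem_standardParabolicGL c u⟩)) fun g => by
      rw [← Module.End.mul_eq_comp, ← Module.End.mul_eq_comp, ← map_mul, ← map_mul,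
        leviProjection_scalar_comm]
  exact ⟨cu, fun w => by rw [hcu]; rfl⟩

end Scalars

/-! ### The central character of `i_c σ` -/

section Center

variable {F : Type*} [Field F] [ValuativeRel F] [TopologicalSpace F] [IsNonarchimedeanLocalField F]
  {n r : ℕ} (c : Fin n → Fin r) {W : Type*} [AddCommGroup W] [Module ℂ W]
  (σ : Representation ℂ (Π a, GL {i // c i = a} F) W)

/-- **A central element of `P_c` acts on `i_c σ` by a scalar** as soon as `σ` acts by a scalar
`c_z` on its Levi projection: `i_c σ (z) = δ_{P_c}^{1/2}(z) c_z · id` (right translation by `z`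
is left translation, and `f(z x) = τ(z) f(x)`). [folklore] -/
theorem parabolicIndGL_apply_of_mem_center {z : GL (Fin n) F}
    (hz : z ∈ Subgroup.center (GL (Fin n) F)) (hzP : z ∈ standardParabolicGL F c) {cz : ℂ}
    (hσz : ∀ w, σ (leviProjection F c ⟨z, hzP⟩) w = cz • w)
    (f : SmoothInd (standardParabolicGL F c)
      (Representation.twist (σ.comp (leviProjection F c))
        (rootDeltaChar (standardParabolicGL F c)))) :
    parabolicIndGL F c σ z f =
      ((((rootDeltaChar (standardParabolicGL F c) ⟨z, hzP⟩ : ℂˣ) : ℂ) * cz) • f) := by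
  refine SmoothInd.ext (funext fun x => ?_)
  change (smoothIndRep _ _ z f).toFun x = _
  rw [toFun_smoothIndRep_apply, SmoothInd.toFun_smul, Pi.smul_apply,
    Subgroup.mem_center_iff.1 hz x]
  have h := f.toFun_subgroup_mul ⟨z, hzP⟩ x
  rw [Subgroup.coe_mk] at h
  rw [h, twist_apply, MonoidHom.comp_apply, hσz, smul_smul]

end Center

/-! ### Casselman's Corollary 5.4.3 for `GL_n(F)` -/

section Main

variable {F : Type*} [Field F] [ValuativeRel F] [TopologicalSpace F] [IsNonarchimedeanLocalField F]
  {n r : ℕ} {c : Fin n → Fin r} {W : Type*} [AddCommGroup W] [Module ℂ W]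
  {σ : Representation ℂ (Π a, GL {i // c i = a} F) W}
  {V : Type*} [AddCommGroup V] [Module ℂ V] {π : Representation ℂ (GL (Fin n) F) V}

/-- **No supercuspidal subquotient in a properly induced representation** (Casselman 1995,
Cor. 5.4.3; Bernstein–Zelevinsky 1977, Thm. 2.4 (d) / Cor. 2.13 (b)). Let `P_c < GL_n(F)` be a
proper standard parabolic (`c` monotone with at least two non-empty blocks), `σ` a representation
of its Levi `Π_a GL_{n_a}(F)` acting by scalars on the Levi projections of the central scalars
`u · 1` (automatic for `σ` irreducible admissible, `exists_apply_leviProjection_scalar_eq_smul`),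
and `π` an irreducible admissible supercuspidal representation of `GL_n(F)`. Then every
intertwining map from a subrepresentation of `i_c σ` to `π` is zero: `π` is not a subquotient of
`i_c σ`. [cite: Casselman1995, Cor. 5.4.3] -/
theorem intertwiningMap_subrepresentation_parabolicIndGL_eq_zero (hcm : Monotone c)
    (hcp : IsProperBlocks c)
    (hσZ : ∀ u : Fˣ, ∃ cu : ℂ, ∀ w,
      σ (leviProjection F c ⟨_, scalar_mem_standardParabolicGL c u⟩) w = cu • w)
    [π.IsIrreducible] (hπa : π.IsAdmissible) (hπc : π.IsSupercuspidal)
    (N : Subrepresentation (parabolicIndGL F c σ)) (q : N.toRepresentation.IntertwiningMap π) :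
    q = 0 := by
  classical
  rcases q.surjective_or_eq_zero with hq | hq
  swap
  · exact hq
  exfalso
  have hπs : π.IsSmooth := hπa.isSmooth
  -- central characters: `π` has one, and `N` acts through the same one
  obtain ⟨χ, hπχ⟩ := hπa.exists_hasCentralCharacter (isOpen_glInt n F) (isCompact_glInt n F)
  have hI : ∀ z : Subgroup.center (GL (Fin n) F), ∃ cz : ℂ,
      ∀ f, parabolicIndGL F c σ (z : GL (Fin n) F) f = cz • f := by
    intro z
    obtain ⟨u, hu⟩ : ∃ u : Fˣ, Matrix.GeneralLinearGroup.scalar (Fin n) u = (z : GL (Fin n) F) := by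
      have hz : (z : GL (Fin n) F) ∈ (Matrix.GeneralLinearGroup.scalar (Fin n) :
          Fˣ →* GL (Fin n) F).range := by
        rw [← Matrix.GeneralLinearGroup.center_eq_range_scalar]; exact z.2
      exact hz
    obtain ⟨cu, hcu⟩ := hσZ u
    have hzP : (z : GL (Fin n) F) ∈ standardParabolicGL F c := hu ▸ scalar_mem_standardParabolicGL c u
    have hσz : ∀ w, σ (leviProjection F c ⟨(z : GL (Fin n) F), hzP⟩) w = cu • w := by
      have heq : (⟨(z : GL (Fin n) F), hzP⟩ : standardParabolicGL F c) =
          ⟨_, scalar_mem_standardParabolicGL c u⟩ := Subtype.ext hu.symm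
      rw [heq]
      exact hcu
    exact ⟨_, parabolicIndGL_apply_of_mem_center c σ z.2 hzP hσz⟩
  have hNχ : N.toRepresentation.HasCentralCharacter χ := by
    intro z
    obtain ⟨cz, hcz⟩ := hI z
    -- `cz = χ z`: compare on a vector of `N` with non-zero image in `π`
    haveI : Nontrivial V := IsIrreducible.nontrivial π
    obtain ⟨v, hv⟩ := exists_ne (0 : V)
    obtain ⟨x, rfl⟩ := hq v
    have h1 : π (z : GL (Fin n) F) (q x) = cz • q x := by
      rw [← q.isIntertwining]
      have hx : N.toRepresentation (z : GL (Fin n) F) x = cz • x := Subtype.ext (hcz x)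
      rw [hx, map_smul]
    have h2 : π (z : GL (Fin n) F) (q x) = ((χ z : ℂˣ) : ℂ) • q x := hπχ.apply z (q x)
    have hc : ((χ z : ℂˣ) : ℂ) = cz := by
      have h := h2.symm.trans h1
      rw [← sub_eq_zero, ← sub_smul] at h
      exact sub_eq_zero.1 ((smul_eq_zero.1 h).resolve_right hv)
    refine LinearMap.ext fun y => Subtype.ext ?_
    change ((parabolicIndGL F c σ (z : GL (Fin n) F)) (y : SmoothInd _ _)) = _
    rw [hcz y, ← hc]
    rfl
  -- projectivity: a section of `q`, hence an embedding `π ↪ i_c σ`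
  have hNs : N.toRepresentation.IsSmooth :=
    (isSmooth_smoothInd (standardParabolicGL F c) _).toRepresentation N
  obtain ⟨s, hs⟩ := hπc.exists_intertwiningMap_comp_eq_id_gl hπa hπχ hNs hNχ q hq
  set f : π.IntertwiningMap (parabolicIndGL F c σ) :=
    (Subrepresentation.subtypeIntertwiningMap N).comp s with hfdef
  haveI : Nontrivial V := IsIrreducible.nontrivial π
  obtain ⟨v, hv⟩ := exists_ne (0 : V)
  have hf : f ≠ 0 := by
    intro hf0
    have h1 : (s v).1 = 0 :=
      congrArg (fun g : π.IntertwiningMap (parabolicIndGL F c σ) => g v) hf0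
    have h2 : s v = 0 := Subtype.ext h1
    have h3 : v = 0 := by rw [← hs v, h2, map_zero]
    exact hv h3
  -- Frobenius: a non-zero map `r̄_c π → σ`, impossible for supercuspidal `π`
  obtain ⟨e⟩ := frobenius_reciprocity_gl_holds (V := V) (W := W) F c π hπs σ
  have hg : e f ≠ 0 := (LinearEquiv.map_ne_zero_iff e).2 hf
  haveI : Subsingleton (restrictUnipotentGL F c π).Coinvariants :=
    ((isSupercuspidal_iff_jacquetGL_holds F (n := n) (V := V)) π hπs).1 hπc r c hcp hcm
  exact hg (IntertwiningMap.ext (LinearMap.ext fun x => by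
    rw [Subsingleton.elim x 0, map_zero, map_zero]))

/-- **Casselman's Corollary 5.4.3 verbatim for `GL_n(F)`**: for a proper standard parabolic
`P_c` and an *irreducible admissible* `σ` of the Levi, no irreducible admissible supercuspidal
`π` is a subquotient of `i_c σ`. [cite: Casselman1995, Cor. 5.4.3] -/
theorem intertwiningMap_subrepresentation_parabolicIndGL_eq_zero_of_isIrreducible
    (hcm : Monotone c) (hcp : IsProperBlocks c) [σ.IsIrreducible] (hσ : σ.IsAdmissible)
    [π.IsIrreducible] (hπa : π.IsAdmissible) (hπc : π.IsSupercuspidal)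
    (N : Subrepresentation (parabolicIndGL F c σ)) (q : N.toRepresentation.IntertwiningMap π) :
    q = 0 :=
  intertwiningMap_subrepresentation_parabolicIndGL_eq_zero hcm hcp
    (exists_apply_leviProjection_scalar_eq_smul σ hσ) hπa hπc N q

end Main

end Literature.NumberTheory.Automorphic
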